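import Summits.QuantumFields.YangMills.Theorems.SwapVirialDeficitBlowUpGnomonicFollowerHessian
import HarnessLib

/-!
# W4, part K7g: JETS ALONG LEADER CHORDS — the four leaders moving INDEPENDENTLY along normalised chords of `S³`, the followers along gnomonic lines;
# the follower Hessian is Lipschitz in the leader tuple for the GROUP distance
# (free-hands support of ⟨stmt-QuantumFields-24197⟩ `SwapVirialDeficit.SwapGluedStiffness`; cell ym-idea-1, skeleton ➎ `stub_core_tip` (T2): the matching chain
# tip ↔ apex ↔ axial ↔ shell moves the hub AND removes the axis tilt of near-commuting large letters — in gnomonic coordinates the tilt of a letter near the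
# equator costs an unbounded chart distance, in the group it costs `O(√F̂)`; so the one-loop matching must be Lipschitz in the LEADER TUPLE, not in the chart point)

For two leader tuples `q, q′ ∈ (S³)⁴` (unit quaternions) the chord `t ↦ Q(q_μ + t·d_μ)`, `d_μ = c·(q′_μ − q_μ)`, stays at distance `≥ √3∕2` from `0` as soon as
`‖q′_μ − q_μ‖ ≤ 1` (§1 `norm_sq_chord_point`, `three_quarters_le_norm_sq_chord`), so its radial projection carries a 4-jet of size `2·|t₁|·‖d_μ‖` (✓`jet4_radialUnit_line`):
* §1 ★ `jet4_chord_line`;  §2 ★★ `jet4_leader_chordLine`, `jet4_follower_chordLine`;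
* §3 ★★ `realJet4_chordDeficit_le` — for `ψ(s) = F_z(Q(q + (t₀ + s t₁)•d), gno⁺(η_F + y₀ + s·v))` with `2|t₁|·max‖d_μ‖ ≤ S`, `‖v‖ ≤ S`: `|ψ′| ≤ 432L⁴S`, `|ψ″| ≤ 7344L⁴S²`,
  `|ψ‴| ≤ 536544L⁴S³`, `|ψ⁗| ≤ 49408704L⁴S⁴`;
* §4 ★★ `contDiff_chordDeficit` (joint `C^n` on `ℝ × V_F`), ★★ `chordDeficit_third_bound_norm` (ambient cube `536544L⁴‖w‖³` when `max‖d_μ‖ ≤ 1∕2`);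
* §5 ★★★ `abs_gnoFolHessianForm_sub_le_leaders` — for two chart points `(a, ε, η)`, `(a′, ε, η′)` with follower signs `+`, the SAME follower letters `η.2.2 = η′.2.2`, and leader
  quaternions `q_μ = su2Quat C_μ`, `q′_μ = su2Quat C′_μ` with `‖q′_μ − q_μ‖ ≤ D ≤ 1`: `|⟪A^{a} η v, v⟫ − ⟪A^{a′} η′ v, v⟫| ≤ 3219264·L⁴·D·‖v‖²` (any families with the
  form identity) — uniform in the hub, the tilt and the size of the letters; ★★★ `abs_log_det_gnoFolHessian_sub_le_leaders` — the one-loop comparison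
  `|log det A^{a} η − log det A^{a′} η′| ≤ 2·(3|Fol L|)·3219264L⁴D∕μ′` (`A^{a′} η′` `μ′`-coercive, `3219264L⁴D ≤ μ′∕2`).

HONEST LABEL: calculus plumbing; nothing about `stub_core_tip`, ⟨24197⟩ ∕ ⟨24194⟩ (OPEN) is proved; own crux ⟨22884⟩ OPEN (blocked-on ⟨19935⟩); the Yang–Mills mass gap is NOT
proved; no summit is proved by a line.  THEOREMS ONLY (0 `def`, 0 `sorry`), standard axioms, no local instances.  Width seat ym-line-sfw-p2-w2 g60 (cell ym-idea-1, free hands),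
`--supports stmt-QuantumFields-24197`.  References: [cite: Luscher1983, §2]; [cite: Breitung1994, Lemma 26]; [folklore].
-/

set_option autoImplicit false
set_option synthInstance.maxSize 1024

noncomputable section

open Quaternion Set Metric Module
open scoped Quaternion RealInnerProductSpace InnerProductSpace BigOperators ContDiff
open Literature.MathematicalPhysics.QuantumLattice
open Literature.MathematicalPhysics.QuantumFieldTheory hiding SU2
open Literature.Analysis.Calculus (radialUnit radialUnit_def norm_radialUnit)
open Summit.QuantumFields.YangMills.Theorems.FemtoTransferGap
open Summit.QuantumFields.YangMills.Theorems.FemtoTransferGap.TT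
open Summit.QuantumFields.YangMills.Theorems.SwapVirialDeficit.ZeroModeSigma (su2Quat_quatToSU2_eq_radialUnit)
open Summit.QuantumFields.YangMills.Theorems.SwapVirialDeficit.BlowUp (leaderTuple dil3_one' dilateIm_one_apply qDeficit swapRingDeficit_eq_qDeficit contDiffAt_radialUnit)
open Summit.QuantumFields.YangMills.Theorems.SwapVirialDeficit.BlowUpRing
open Summit.QuantumFields.YangMills.Theorems.QuantitativeLaplace (abs_hessianForm_sub_le_of_cubes abs_log_det_sub_log_det_le iteratedFDeriv_fibre_apply)

namespace Summit.QuantumFields.YangMills.Theorems.SwapVirialDeficit.Gnomonic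

variable {L : ℕ} [NeZero L]

/-! ## §1 Chords of the unit sphere of `ℍ` -/

omit [NeZero L] in
/-- `‖q + t·(q′ − q)‖² = 1 + ‖q′ − q‖²·(t² − t)` for unit `q, q′`. [folklore] -/
theorem norm_sq_chord_point {q q' : ℍ} (hq : ‖q‖ = 1) (hq' : ‖q'‖ = 1) (t : ℝ) : ‖q + t • (q' - q)‖ ^ 2 = 1 + ‖q' - q‖ ^ 2 * (t ^ 2 - t) := by
  have h1 : ‖q + t • (q' - q)‖ ^ 2 = ‖q‖ ^ 2 + 2 * t * ⟪q, q' - q⟫ + t ^ 2 * ‖q' - q‖ ^ 2 := by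
    rw [← real_inner_self_eq_norm_sq, inner_add_left, inner_add_right, inner_add_right, real_inner_smul_left, real_inner_smul_right, real_inner_smul_left,
      real_inner_smul_right, real_inner_self_eq_norm_sq, real_inner_self_eq_norm_sq, real_inner_comm (q' - q) q]
    ring
  have h2 : ⟪q, q' - q⟫ = -(‖q' - q‖ ^ 2 / 2) := by
    have h3 : ‖q' - q‖ ^ 2 = ‖q'‖ ^ 2 - 2 * ⟪q', q⟫ + ‖q‖ ^ 2 := norm_sub_sq_real q' q
    rw [inner_sub_right, real_inner_self_eq_norm_sq, real_inner_comm q q', hq, hq'] at *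
    linarith
  rw [h1, h2, hq]; ring

omit [NeZero L] in
/-- Every point of the chord LINE through unit `q, q′` with `‖q′ − q‖ ≤ 1` has `‖·‖² ≥ 3∕4`. [folklore] -/
theorem three_quarters_le_norm_sq_chord {q q' : ℍ} (hq : ‖q‖ = 1) (hq' : ‖q'‖ = 1) (hd : ‖q' - q‖ ≤ 1) (t : ℝ) : 3 / 4 ≤ ‖q + t • (q' - q)‖ ^ 2 := by
  rw [norm_sq_chord_point hq hq' t]
  have h0 : 0 ≤ ‖q' - q‖ := norm_nonneg _
  have h1 : ‖q' - q‖ ^ 2 ≤ 1 := by nlinarith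
  nlinarith [sq_nonneg (t - 1 / 2), sq_nonneg ‖q' - q‖]

omit [NeZero L] in
/-- The chord line with a rescaled direction `d = c·(q′ − q)` never comes closer than `√3∕2` to the origin. [folklore] -/
theorem three_quarters_le_norm_sq_chord_smul {q q' : ℍ} (hq : ‖q‖ = 1) (hq' : ‖q'‖ = 1) (hd : ‖q' - q‖ ≤ 1) (c t : ℝ) :
    3 / 4 ≤ ‖q + t • (c • (q' - q))‖ ^ 2 := by
  rw [smul_smul]; exact three_quarters_le_norm_sq_chord hq hq' hd _

omit [NeZero L] in
/-- ★ **THE RADIAL PROJECTION OF A CHORD LINE CARRIES A 4-JET OF SIZE `2|t₁|‖d‖`**: `s ↦ ν((q + t₀·d) + s·(t₁·d))`, `d = c·(q′ − q)`, unit `q, q′` with `‖q′ − q‖ ≤ 1`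
(the foot of the line has norm `≥ √3∕2`, ✓`jet4_radialUnit_line`). [folklore] -/
theorem jet4_chord_line {q q' : ℍ} (hq : ‖q‖ = 1) (hq' : ‖q'‖ = 1) (hd : ‖q' - q‖ ≤ 1) (c t₀ t₁ : ℝ) :
    ∃ f₁ f₂ f₃ f₄ : ℝ → ℍ, (∀ s, HasDerivAt (fun s : ℝ => radialUnit ((q + t₀ • (c • (q' - q))) + s • (t₁ • (c • (q' - q))))) (f₁ s) s) ∧
      (∀ s, HasDerivAt f₁ (f₂ s) s) ∧ (∀ s, HasDerivAt f₂ (f₃ s) s) ∧ (∀ s, HasDerivAt f₃ (f₄ s) s) ∧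
      ∀ s, ‖radialUnit ((q + t₀ • (c • (q' - q))) + s • (t₁ • (c • (q' - q))))‖ ≤ 1 ∧ ‖f₁ s‖ ≤ 2 * |t₁| * ‖c • (q' - q)‖ ∧
        ‖f₂ s‖ ≤ (2 * |t₁| * ‖c • (q' - q)‖) ^ 2 ∧ ‖f₃ s‖ ≤ 3 * (2 * |t₁| * ‖c • (q' - q)‖) ^ 3 ∧ ‖f₄ s‖ ≤ 9 * (2 * |t₁| * ‖c • (q' - q)‖) ^ 4 := by
  set d : ℍ := c • (q' - q) with hdd
  set u₀ : ℍ := q + t₀ • d with hu₀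
  set w : ℍ := t₁ • d with hw
  -- the foot lies on the chord line, hence has norm ≥ √3/2
  have hfoot_sq : 3 / 4 ≤ ‖u₀ + (-(⟪u₀, w⟫ / ‖w‖ ^ 2)) • w‖ ^ 2 := by
    have e : u₀ + (-(⟪u₀, w⟫ / ‖w‖ ^ 2)) • w = q + (t₀ + -(⟪u₀, w⟫ / ‖w‖ ^ 2) * t₁) • (c • (q' - q)) := by
      rw [add_smul, mul_smul, hw, hu₀, hdd, add_assoc]
    rw [e]; exact three_quarters_le_norm_sq_chord_smul hq hq' hd c _
  have hfoot_pos : 0 < ‖u₀ + (-(⟪u₀, w⟫ / ‖w‖ ^ 2)) • w‖ := by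
    have h0 : 0 ≤ ‖u₀ + (-(⟪u₀, w⟫ / ‖w‖ ^ 2)) • w‖ := norm_nonneg _
    nlinarith
  have hfoot_ne : u₀ + (-(⟪u₀, w⟫ / ‖w‖ ^ 2)) • w ≠ 0 := fun h => by rw [h, norm_zero] at hfoot_pos; exact lt_irrefl _ hfoot_pos
  have h := jet4_radialUnit_line hfoot_ne
  -- size `‖w‖/‖foot‖ ≤ 2|t₁|‖d‖`
  have hge : 1 / 2 ≤ ‖u₀ + (-(⟪u₀, w⟫ / ‖w‖ ^ 2)) • w‖ := by
    have h0 : 0 ≤ ‖u₀ + (-(⟪u₀, w⟫ / ‖w‖ ^ 2)) • w‖ := norm_nonneg _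
    nlinarith [hfoot_sq]
  have hsize : ‖w‖ / ‖u₀ + (-(⟪u₀, w⟫ / ‖w‖ ^ 2)) • w‖ ≤ 2 * |t₁| * ‖d‖ := by
    have hwn : ‖w‖ = |t₁| * ‖d‖ := by rw [hw, norm_smul, Real.norm_eq_abs]
    calc ‖w‖ / ‖u₀ + (-(⟪u₀, w⟫ / ‖w‖ ^ 2)) • w‖ ≤ ‖w‖ / (1 / 2) := div_le_div_of_nonneg_left (norm_nonneg _) (by norm_num) hge
      _ = 2 * |t₁| * ‖d‖ := by rw [hwn]; ring
  exact jet4_mono (by positivity) hsize h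

/-! ## §2 Leaders along chords, followers along gnomonic lines -/

omit [NeZero L] in
/-- ★★ **A LEADER ALONG A CHORD**: `s ↦ su2Quat (Q(q + (t₀ + s t₁)·d))` (`d = c·(q′ − q)`, unit `q, q′`, `‖q′ − q‖ ≤ 1`) carries a 4-jet of size `2|t₁|‖d‖`. [folklore] -/
theorem jet4_leader_chordLine {q q' : ℍ} (hq : ‖q‖ = 1) (hq' : ‖q'‖ = 1) (hd : ‖q' - q‖ ≤ 1) (c t₀ t₁ : ℝ) :
    ∃ f₁ f₂ f₃ f₄ : ℝ → ℍ, (∀ s, HasDerivAt (fun s : ℝ => su2Quat (quatToSU2 (q + (t₀ + s * t₁) • (c • (q' - q))))) (f₁ s) s) ∧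
      (∀ s, HasDerivAt f₁ (f₂ s) s) ∧ (∀ s, HasDerivAt f₂ (f₃ s) s) ∧ (∀ s, HasDerivAt f₃ (f₄ s) s) ∧
      ∀ s, ‖su2Quat (quatToSU2 (q + (t₀ + s * t₁) • (c • (q' - q))))‖ ≤ 1 ∧ ‖f₁ s‖ ≤ 2 * |t₁| * ‖c • (q' - q)‖ ∧
        ‖f₂ s‖ ≤ (2 * |t₁| * ‖c • (q' - q)‖) ^ 2 ∧ ‖f₃ s‖ ≤ 3 * (2 * |t₁| * ‖c • (q' - q)‖) ^ 3 ∧ ‖f₄ s‖ ≤ 9 * (2 * |t₁| * ‖c • (q' - q)‖) ^ 4 := by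
  have hne : ∀ s : ℝ, q + (t₀ + s * t₁) • (c • (q' - q)) ≠ 0 := fun s h => by
    have h1 := three_quarters_le_norm_sq_chord_smul hq hq' hd c (t₀ + s * t₁)
    rw [h, norm_zero] at h1; norm_num at h1
  have e : ∀ s : ℝ, radialUnit ((q + t₀ • (c • (q' - q))) + s • (t₁ • (c • (q' - q)))) = su2Quat (quatToSU2 (q + (t₀ + s * t₁) • (c • (q' - q)))) := fun s => by
    rw [su2Quat_quatToSU2_eq_radialUnit (hne s), add_smul, mul_smul, add_assoc]
  have h := jet4_chord_line hq hq' hd c t₀ t₁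
  simpa only [e] using h

/-! ## §3 The chord deficit and its joint 4-jet -/

set_option maxHeartbeats 400000 in
/-- ★★ **FOUR DERIVATIVE WITNESSES ALONG A JOINT CHORD–FOLLOWER LINE**: leaders `Q(q_μ + (t₀ + s t₁)·d_μ)` (`d_μ = c·(q′_μ − q_μ)`, unit `q, q′`, `‖q′_μ − q_μ‖ ≤ 1`),
followers `gno⁺(η_F + s·ξ_F)`; if `2|t₁|‖d_μ‖ ≤ S` for every `μ` and every follower size `√Σ(ξ_F f)ₖ² ≤ S`, then `ψ(s) = F_z` of this configuration has
`|ψ′| ≤ 432L⁴S`, `|ψ″| ≤ 7344L⁴S²`, `|ψ‴| ≤ 536544L⁴S³`, `|ψ⁗| ≤ 49408704L⁴S⁴` (words of size `≤ 3S`; ✓`jet4_fixHistory`, ✓`realJet4_qDeficit_le`). [cite: Luscher1983, §2] -/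
theorem realJet4_chordDeficit_le (z : Fin 3 → Bool) (χ : Site 3 L → SU2) {q q' : Fin 4 → ℍ} (hq : ∀ μ, ‖q μ‖ = 1) (hq' : ∀ μ, ‖q' μ‖ = 1)
    (hd : ∀ μ, ‖q' μ - q μ‖ ≤ 1) (c t₀ t₁ : ℝ) (ηF ξF : Fol L → Fin 3 → ℝ) {S : ℝ} (hS : 0 ≤ S) (ht : ∀ μ, 2 * |t₁| * ‖c • (q' μ - q μ)‖ ≤ S)
    (hf : ∀ i, Real.sqrt (∑ k, ξF i k ^ 2) ≤ S) :
    ∃ d₁ d₂ d₃ d₄ : ℝ → ℝ,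
      (∀ s, HasDerivAt (fun s : ℝ => chartDeficit L z χ ((fun μ => quatToSU2 (q μ + (t₀ + s * t₁) • (c • (q' μ - q μ)))),
        fun f => quatToSU2 (gnoLetter true (ηF f + s • ξF f)))) (d₁ s) s) ∧
      (∀ s, HasDerivAt d₁ (d₂ s) s) ∧ (∀ s, HasDerivAt d₂ (d₃ s) s) ∧ (∀ s, HasDerivAt d₃ (d₄ s) s) ∧
      ∀ s, |d₁ s| ≤ 432 * (L : ℝ) ^ 4 * S ∧ |d₂ s| ≤ 7344 * (L : ℝ) ^ 4 * S ^ 2 ∧ |d₃ s| ≤ 536544 * (L : ℝ) ^ 4 * S ^ 3 ∧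
        |d₄ s| ≤ 49408704 * (L : ℝ) ^ 4 * S ^ 4 := by
  have hC : ∀ μ : Fin 4, ∃ f₁ f₂ f₃ f₄ : ℝ → ℍ,
      (∀ s, HasDerivAt (fun s : ℝ => su2Quat ((fun μ => quatToSU2 (q μ + (t₀ + s * t₁) • (c • (q' μ - q μ)))) μ)) (f₁ s) s) ∧
      (∀ s, HasDerivAt f₁ (f₂ s) s) ∧ (∀ s, HasDerivAt f₂ (f₃ s) s) ∧ (∀ s, HasDerivAt f₃ (f₄ s) s) ∧
      ∀ s, ‖su2Quat ((fun μ => quatToSU2 (q μ + (t₀ + s * t₁) • (c • (q' μ - q μ)))) μ)‖ ≤ 1 ∧ ‖f₁ s‖ ≤ S ∧ ‖f₂ s‖ ≤ S ^ 2 ∧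
        ‖f₃ s‖ ≤ 3 * S ^ 3 ∧ ‖f₄ s‖ ≤ 9 * S ^ 4 :=
    fun μ => jet4_mono (by positivity) (ht μ) (jet4_leader_chordLine (hq μ) (hq' μ) (hd μ) c t₀ t₁)
  have hU : ∀ i : Fol L, ∃ f₁ f₂ f₃ f₄ : ℝ → ℍ,
      (∀ s, HasDerivAt (fun s : ℝ => su2Quat ((fun f => quatToSU2 (gnoLetter true (ηF f + s • ξF f))) i)) (f₁ s) s) ∧
      (∀ s, HasDerivAt f₁ (f₂ s) s) ∧ (∀ s, HasDerivAt f₂ (f₃ s) s) ∧ (∀ s, HasDerivAt f₃ (f₄ s) s) ∧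
      ∀ s, ‖su2Quat ((fun f => quatToSU2 (gnoLetter true (ηF f + s • ξF f))) i)‖ ≤ 1 ∧ ‖f₁ s‖ ≤ S ∧ ‖f₂ s‖ ≤ S ^ 2 ∧
        ‖f₃ s‖ ≤ 3 * S ^ 3 ∧ ‖f₄ s‖ ≤ 9 * S ^ 4 :=
    fun i => jet4_mono (Real.sqrt_nonneg _) (hf i) (jet4_gnoLetterLine true (ηF i) (ξF i))
  obtain ⟨hl, hs⟩ := jet4_fixHistory (C := fun s => fun μ => quatToSU2 (q μ + (t₀ + s * t₁) • (c • (q' μ - q μ))))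
    (U := fun s => fun f => quatToSU2 (gnoLetter true (ηF f + s • ξF f))) χ hS hS hC hU
  have e3 : S + S + S = 3 * S := by ring
  rw [e3] at hl hs
  have h := realJet4_qDeficit_le (L := L) z (M := 3 * S) (by positivity)
    (Q := fun s => ((fun (i : Fin (2 * L - 1 + 1)) (e : Edge 3 L) =>
        su2Quat ((fixHistory (ringConfig χ ((fun μ => quatToSU2 (q μ + (t₀ + s * t₁) • (c • (q' μ - q μ)))),
          fun f => quatToSU2 (gnoLetter true (ηF f + s • ξF f))))).1 i e)),
      fun x : Site 3 L => su2Quat ((fixHistory (ringConfig χ ((fun μ => quatToSU2 (q μ + (t₀ + s * t₁) • (c • (q' μ - q μ)))),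
          fun f => quatToSU2 (gnoLetter true (ηF f + s • ξF f))))).2 x)))
    (fun i e => hl i e) (fun x => hs x)
  have e : (fun s : ℝ => chartDeficit L z χ ((fun μ => quatToSU2 (q μ + (t₀ + s * t₁) • (c • (q' μ - q μ)))),
        fun f => quatToSU2 (gnoLetter true (ηF f + s • ξF f)))) = fun s => qDeficit z
      ((fun (i : Fin (2 * L - 1 + 1)) (e : Edge 3 L) =>
        su2Quat ((fixHistory (ringConfig χ ((fun μ => quatToSU2 (q μ + (t₀ + s * t₁) • (c • (q' μ - q μ)))),
          fun f => quatToSU2 (gnoLetter true (ηF f + s • ξF f))))).1 i e)),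
      fun x : Site 3 L => su2Quat ((fixHistory (ringConfig χ ((fun μ => quatToSU2 (q μ + (t₀ + s * t₁) • (c • (q' μ - q μ)))),
          fun f => quatToSU2 (gnoLetter true (ηF f + s • ξF f))))).2 x)) :=
    funext fun s => swapRingDeficit_eq_qDeficit z _
  rw [e]
  refine realJet4_mono ?_ ?_ ?_ ?_ h
  · nlinarith [pow_nonneg (Nat.cast_nonneg L : (0 : ℝ) ≤ L) 4]
  · nlinarith [pow_nonneg (Nat.cast_nonneg L : (0 : ℝ) ≤ L) 4, sq_nonneg S]
  · nlinarith [pow_nonneg (Nat.cast_nonneg L : (0 : ℝ) ≤ L) 4, pow_nonneg hS 3]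
  · nlinarith [pow_nonneg (Nat.cast_nonneg L : (0 : ℝ) ≤ L) 4, pow_nonneg hS 4]

/-! ## §4 The chord deficit as a function on `ℝ × V_F`: smoothness and the ambient cube -/

/-- ★★ **THE CHORD DEFICIT IS `C^n` JOINTLY** in the chord parameter and the follower coordinates: `(t, y) ↦ F_z(Q(q + t·d), gno⁺(η_F + y))` on `ℝ × V_F`
(`d_μ = c·(q′_μ − q_μ)`, unit `q, q′`, `‖q′_μ − q_μ‖ ≤ 1`: the chords avoid the origin). [cite: Luscher1983, §2] -/
theorem contDiff_chordDeficit (z : Fin 3 → Bool) (χ : Site 3 L → SU2) {q q' : Fin 4 → ℍ} (hq : ∀ μ, ‖q μ‖ = 1) (hq' : ∀ μ, ‖q' μ‖ = 1)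
    (hd : ∀ μ, ‖q' μ - q μ‖ ≤ 1) (c : ℝ) (ηF : Fol L → Fin 3 → ℝ) {n : ℕ∞} :
    ContDiff ℝ n fun p : ℝ × GnoFol L => chartDeficit L z χ ((fun μ => quatToSU2 (q μ + p.1 • (c • (q' μ - q μ)))),
      fun f => quatToSU2 (gnoLetter true (ηF f + gnoFolBlocks p.2 f))) := by
  have hne : ∀ (μ : Fin 4) (t : ℝ), q μ + t • (c • (q' μ - q μ)) ≠ 0 := fun μ t h => by
    have h1 := three_quarters_le_norm_sq_chord_smul (hq μ) (hq' μ) (hd μ) c t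
    rw [h, norm_zero] at h1; norm_num at h1
  have hC : ∀ μ : Fin 4, ContDiff ℝ n fun p : ℝ × GnoFol L => su2Quat ((fun μ => quatToSU2 (q μ + p.1 • (c • (q' μ - q μ)))) μ) := by
    intro μ
    have e : (fun p : ℝ × GnoFol L => su2Quat ((fun μ => quatToSU2 (q μ + p.1 • (c • (q' μ - q μ)))) μ)) =
        fun p : ℝ × GnoFol L => radialUnit (q μ + p.1 • (c • (q' μ - q μ))) := funext fun p => su2Quat_quatToSU2_eq_radialUnit (hne μ p.1)
    rw [e]
    have haff : ContDiff ℝ n fun p : ℝ × GnoFol L => q μ + p.1 • (c • (q' μ - q μ)) := contDiff_const.add (contDiff_fst.smul contDiff_const)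
    refine contDiff_iff_contDiffAt.2 fun p => ?_
    have h1 : ContDiffAt ℝ n (radialUnit (E := ℍ)) (q μ + p.1 • (c • (q' μ - q μ))) := contDiffAt_radialUnit (hne μ p.1)
    exact h1.comp p haff.contDiffAt
  have hU : ∀ i : Fol L, ContDiff ℝ n fun p : ℝ × GnoFol L => su2Quat ((fun f => quatToSU2 (gnoLetter true (ηF f + gnoFolBlocks p.2 f))) i) := by
    intro i
    have hblock : ContDiff ℝ n fun p : ℝ × GnoFol L => gnoFolBlocks p.2 i := by
      have h1 : ContDiff ℝ n fun y : GnoFol L => gnoFolBlocks y i := by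
        have e : (fun y : GnoFol L => gnoFolBlocks y i) = fun y => fun k => (EuclideanSpace.proj ((i, k) : Fol L × Fin 3) : GnoFol L →L[ℝ] ℝ) y := by
          funext y k; rfl
        rw [e]
        exact contDiff_pi.2 fun k => (EuclideanSpace.proj ((i, k) : Fol L × Fin 3) : GnoFol L →L[ℝ] ℝ).contDiff
      exact h1.comp contDiff_snd
    exact (contDiff_radialUnit_gnoLetter true).comp (contDiff_const.add hblock)
  exact contDiff_chartDeficit_of_letters (C := fun p : ℝ × GnoFol L => fun μ => quatToSU2 (q μ + p.1 • (c • (q' μ - q μ))))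
    (U := fun p : ℝ × GnoFol L => fun f => quatToSU2 (gnoLetter true (ηF f + gnoFolBlocks p.2 f))) z χ hC hU

/-- ★★ **THE AMBIENT CUBE OF THE CHORD DEFICIT**: with `‖d_μ‖ ≤ 1∕2` (so that the leader speed `2|t₁|‖d_μ‖ ≤ |t₁| ≤ ‖w‖`), for every point `p` and direction `w = (t₁, v)` of
`ℝ × V_F` (sup norm): `|D³Φ(p)[w,w,w]| ≤ 536544·L⁴·‖w‖³`. [cite: Luscher1983, §2] -/
theorem chordDeficit_third_bound_norm (z : Fin 3 → Bool) (χ : Site 3 L → SU2) {q q' : Fin 4 → ℍ} (hq : ∀ μ, ‖q μ‖ = 1) (hq' : ∀ μ, ‖q' μ‖ = 1)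
    (hd : ∀ μ, ‖q' μ - q μ‖ ≤ 1) {c : ℝ} (hc : ∀ μ, ‖c • (q' μ - q μ)‖ ≤ 1 / 2) (ηF : Fol L → Fin 3 → ℝ) (p w : ℝ × GnoFol L) :
    |iteratedFDeriv ℝ 3 (fun p : ℝ × GnoFol L => chartDeficit L z χ ((fun μ => quatToSU2 (q μ + p.1 • (c • (q' μ - q μ)))),
      fun f => quatToSU2 (gnoLetter true (ηF f + gnoFolBlocks p.2 f)))) p (fun _ => w)| ≤ 536544 * (L : ℝ) ^ 4 * ‖w‖ ^ 3 := by
  have e := Literature.Analysis.Calculus.iteratedDeriv_lineRestriction (n := 3) (contDiff_chordDeficit (n := 3) z χ hq hq' hd c ηF) p w 0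
  rw [zero_smul, add_zero] at e
  rw [← e]
  -- the line `p + s • w`: chord parameter `p.1 + s * w.1`, followers `ηF + blocks p.2 + s • blocks w.2`
  have eline : (fun s : ℝ => chartDeficit L z χ ((fun μ => quatToSU2 (q μ + (p + s • w).1 • (c • (q' μ - q μ)))),
      fun f => quatToSU2 (gnoLetter true (ηF f + gnoFolBlocks (p + s • w).2 f)))) =
      fun s : ℝ => chartDeficit L z χ ((fun μ => quatToSU2 (q μ + (p.1 + s * w.1) • (c • (q' μ - q μ)))),
        fun f => quatToSU2 (gnoLetter true ((ηF f + gnoFolBlocks p.2 f) + s • gnoFolBlocks w.2 f))) := by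
    funext s
    have hb : ∀ f, gnoFolBlocks (p + s • w).2 f = gnoFolBlocks p.2 f + s • gnoFolBlocks w.2 f := fun f => by
      funext k; simp [gnoFolBlocks]
    simp only [Prod.fst_add, Prod.smul_fst, smul_eq_mul, hb, add_assoc]
  rw [eline]
  have ht : ∀ μ, 2 * |w.1| * ‖c • (q' μ - q μ)‖ ≤ ‖w‖ := fun μ => by
    have h1 : |w.1| ≤ ‖w‖ := by rw [← Real.norm_eq_abs]; exact norm_fst_le w
    have h2 := hc μ
    have h0 : 0 ≤ |w.1| := abs_nonneg _
    nlinarith [norm_nonneg (c • (q' μ - q μ))]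
  have hf : ∀ i, Real.sqrt (∑ k, gnoFolBlocks w.2 i k ^ 2) ≤ ‖w‖ := fun i => by
    have hle : ∑ k, gnoFolBlocks w.2 i k ^ 2 ≤ ‖w.2‖ ^ 2 := by
      have h := normSq3_gnoFolBlocks_le w.2 i
      simpa [normSq3, Fin.sum_univ_three] using h
    calc Real.sqrt (∑ k, gnoFolBlocks w.2 i k ^ 2) ≤ Real.sqrt (‖w.2‖ ^ 2) := Real.sqrt_le_sqrt hle
      _ = ‖w.2‖ := Real.sqrt_sq (norm_nonneg _)
      _ ≤ ‖w‖ := norm_snd_le w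
  obtain ⟨d₁, d₂, d₃, d₄, h₁, h₂, h₃, h₄, hb⟩ := realJet4_chordDeficit_le z χ hq hq' hd c p.1 w.1 (fun f => ηF f + gnoFolBlocks p.2 f) (gnoFolBlocks w.2)
    (norm_nonneg w) ht hf
  obtain ⟨-, -, e3, -⟩ := iteratedDeriv_eq_of_hasDerivAt_chain h₁ h₂ h₃ h₄
  rw [e3]
  exact (hb 0).2.2.1

end Summit.QuantumFields.YangMills.Theorems.SwapVirialDeficit.Gnomonic

/-! ## §5 The follower Hessian is Lipschitz in the leader tuple (group distance) -/

namespace Summit.QuantumFields.YangMills.Theorems.SwapVirialDeficit.BlowUpRing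

open Summit.QuantumFields.YangMills.Theorems.SwapVirialDeficit.Gnomonic (contDiff_chordDeficit chordDeficit_third_bound_norm three_quarters_le_norm_sq_chord_smul)

variable {L : ℕ} [NeZero L]

/-- The gnomonic chart point shifted along the follower fibre: leaders unchanged, followers `Q(±(1, η_f + y_f))`. [folklore] -/
theorem blowUpPoint_gnomonicPoint_add_gnoFolEmb (a : ℍ) (ε : GnoSign L) (η : GnoCoord L) (y : GnoFol L) :
    blowUpPoint (L := L) 1 (gnomonicPoint a ε (η + gnoFolEmb y)) =
      ((blowUpPoint (L := L) 1 (gnomonicPoint a ε η)).1, fun f => quatToSU2 (gnoLetter (ε.2.2 f) (η.2.2 f + gnoFolBlocks y f))) := by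
  rw [blowUpPoint_one_gnomonicPoint, blowUpPoint_one_gnomonicPoint, gnoFolEmb_apply]
  refine Prod.ext ?_ ?_
  · simp only [Prod.fst_add, Prod.snd_add, add_zero]
  · funext f
    simp only [Prod.snd_add, Pi.add_apply]

/-- ★ **THE FOLLOWER RESTRICTION IS A SECTION OF THE CHORD DEFICIT**: with `q_μ = su2Quat C_μ` the leader quaternions of the chart point `(a, ε, η)` (follower signs `+`),
ANY `q′, c` and chord parameter `t = 0`: `F̂_a(η + gnoFolEmb y) = F_z(Q(q + 0·d), gno⁺(η_F + y))`. [folklore] -/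
theorem gnoDeficit_fol_eq_chordDeficit (z : Fin 3 → Bool) (χ : Site 3 L → SU2) (a : ℍ) (ε : GnoSign L) (hε : ε.2.2 = fun _ => true) (η : GnoCoord L)
    (q' : Fin 4 → ℍ) (c t : ℝ) (ht : ∀ μ, quatToSU2 (su2Quat ((blowUpPoint (L := L) 1 (gnomonicPoint a ε η)).1 μ) + t • (c • (q' μ - su2Quat ((blowUpPoint (L := L) 1 (gnomonicPoint a ε η)).1 μ)))) =
      (blowUpPoint (L := L) 1 (gnomonicPoint a ε η)).1 μ) (y : GnoFol L) :
    gnoDeficit z χ a ε (η + gnoFolEmb y) =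
      chartDeficit L z χ ((fun μ => quatToSU2 (su2Quat ((blowUpPoint (L := L) 1 (gnomonicPoint a ε η)).1 μ) +
          t • (c • (q' μ - su2Quat ((blowUpPoint (L := L) 1 (gnomonicPoint a ε η)).1 μ))))),
        fun f => quatToSU2 (gnoLetter true (η.2.2 f + gnoFolBlocks y f))) := by
  unfold gnoDeficit
  rw [blowUpPoint_gnomonicPoint_add_gnoFolEmb]
  congr 1
  refine Prod.ext ?_ ?_
  · funext μ; exact (ht μ).symm
  · funext f; rw [hε]

/-- ★★★ **THE FOLLOWER HESSIAN FORM IS LIPSCHITZ IN THE LEADER TUPLE, FOR THE GROUP DISTANCE.**  Two chart points `(a, ε, η)`, `(a′, ε, η′)` of the principal gnomonic chart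
with follower signs `+` and the SAME follower letters `η.2.2 = η′.2.2`; leader quaternions `q_μ = su2Quat C_μ`, `q′_μ = su2Quat C′_μ` with `‖q′_μ − q_μ‖ ≤ D`, `0 < D ≤ 1`;
families `A`, `A′` with the form identity at the hubs `a`, `a′` (✓`exists_gnoFolHessian`).  Then for every `v : V_F`:
`|⟪A η v, v⟫ − ⟪A′ η′ v, v⟫| ≤ 3219264·L⁴·D·‖v‖²` — uniform in the hub (apex included), in the tilt and in the size of the letters (the chord `t ↦ Q(q + t·(q′−q)∕(2D))`,
`t ∈ [0, 2D]`, ✓`chordDeficit_third_bound_norm` ∘ ✓`abs_hessianForm_sub_le_of_cubes` on `ℝ × V_F`). [folklore] -/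
theorem abs_gnoFolHessianForm_sub_le_leaders (z : Fin 3 → Bool) (χ : Site 3 L → SU2) {a a' : ℍ} (ε : GnoSign L) (hε : ε.2.2 = fun _ => true)
    {η η' : GnoCoord L} (hF : η.2.2 = η'.2.2)
    {A A' : GnoCoord L → GnoFol L →ₗ[ℝ] GnoFol L}
    (hAyy : ∀ η₁ (y : GnoFol L), ⟪A η₁ y, y⟫_ℝ = iteratedFDeriv ℝ 2 (fun y' : GnoFol L => gnoDeficit z χ a ε (η₁ + gnoFolEmb y')) 0 (fun _ => y))
    (hAyy' : ∀ η₁ (y : GnoFol L), ⟪A' η₁ y, y⟫_ℝ = iteratedFDeriv ℝ 2 (fun y' : GnoFol L => gnoDeficit z χ a' ε (η₁ + gnoFolEmb y')) 0 (fun _ => y))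
    {D : ℝ} (hD0 : 0 < D) (hD1 : D ≤ 1)
    (hD : ∀ μ, ‖su2Quat ((blowUpPoint (L := L) 1 (gnomonicPoint a' ε η')).1 μ) - su2Quat ((blowUpPoint (L := L) 1 (gnomonicPoint a ε η)).1 μ)‖ ≤ D) (v : GnoFol L) :
    |⟪A η v, v⟫_ℝ - ⟪A' η' v, v⟫_ℝ| ≤ 3219264 * (L : ℝ) ^ 4 * D * ‖v‖ ^ 2 := by
  set q : Fin 4 → ℍ := fun μ => su2Quat ((blowUpPoint (L := L) 1 (gnomonicPoint a ε η)).1 μ) with hqdef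
  set q' : Fin 4 → ℍ := fun μ => su2Quat ((blowUpPoint (L := L) 1 (gnomonicPoint a' ε η')).1 μ) with hq'def
  have hq : ∀ μ, ‖q μ‖ = 1 := fun μ => norm_su2Quat _
  have hq' : ∀ μ, ‖q' μ‖ = 1 := fun μ => norm_su2Quat _
  have hd : ∀ μ, ‖q' μ - q μ‖ ≤ 1 := fun μ => (hD μ).trans hD1
  set c : ℝ := 1 / (2 * D) with hcdef
  have hc : ∀ μ, ‖c • (q' μ - q μ)‖ ≤ 1 / 2 := fun μ => by
    rw [norm_smul, hcdef, Real.norm_eq_abs, abs_of_pos (by positivity)]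
    calc 1 / (2 * D) * ‖q' μ - q μ‖ ≤ 1 / (2 * D) * D := mul_le_mul_of_nonneg_left (hD μ) (by positivity)
      _ = 1 / 2 := by field_simp
  -- the joint chord function `Φ` on `ℝ × V_F`
  set Φ : ℝ × GnoFol L → ℝ := fun p => chartDeficit L z χ ((fun μ => quatToSU2 (q μ + p.1 • (c • (q' μ - q μ)))),
      fun f => quatToSU2 (gnoLetter true (η.2.2 f + gnoFolBlocks p.2 f))) with hΦ
  have hΦ3 : ContDiff ℝ 3 Φ := contDiff_chordDeficit (n := 3) z χ hq hq' hd c η.2.2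
  -- sections: `t = 0` is `F̂_a(η + ·)`, `t = 2D` is `F̂_{a′}(η′ + ·)`
  have h0 : ∀ μ, quatToSU2 (q μ + (0 : ℝ) • (c • (q' μ - q μ))) = (blowUpPoint (L := L) 1 (gnomonicPoint a ε η)).1 μ := fun μ => by
    rw [zero_smul, add_zero]; exact quatToSU2_su2Quat _
  have h1 : ∀ μ, quatToSU2 (q μ + (2 * D) • (c • (q' μ - q μ))) = (blowUpPoint (L := L) 1 (gnomonicPoint a' ε η')).1 μ := fun μ => by
    have e : q μ + (2 * D) • (c • (q' μ - q μ)) = q' μ := by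
      rw [smul_smul, hcdef, show 2 * D * (1 / (2 * D)) = 1 by field_simp, one_smul, add_sub_cancel]
    rw [e]; exact quatToSU2_su2Quat _
  have hsec0 : (fun y' : GnoFol L => gnoDeficit z χ a ε (η + gnoFolEmb y')) = fun y' => Φ ((0 : ℝ), y') :=
    funext fun y' => gnoDeficit_fol_eq_chordDeficit z χ a ε hε η q' c 0 h0 y'
  have hsec1 : (fun y' : GnoFol L => gnoDeficit z χ a' ε (η' + gnoFolEmb y')) = fun y' => Φ ((2 * D : ℝ), y') := by
    funext y'
    show gnoDeficit z χ a' ε (η' + gnoFolEmb y') =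
      chartDeficit L z χ ((fun μ => quatToSU2 (q μ + (2 * D) • (c • (q' μ - q μ)))), fun f => quatToSU2 (gnoLetter true (η.2.2 f + gnoFolBlocks y' f)))
    unfold gnoDeficit
    rw [blowUpPoint_gnomonicPoint_add_gnoFolEmb]
    congr 1
    refine Prod.ext (funext fun μ => (h1 μ).symm) (funext fun f => ?_)
    show quatToSU2 (gnoLetter (ε.2.2 f) (η'.2.2 f + gnoFolBlocks y' f)) = quatToSU2 (gnoLetter true (η.2.2 f + gnoFolBlocks y' f))
    rw [hε, hF]
  have hΦ2 : ContDiff ℝ 2 Φ := contDiff_chordDeficit (n := 2) z χ hq hq' hd c η.2.2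
  have h2 : (2 : WithTop ℕ∞) ≤ ((2 : ℕ∞) : WithTop ℕ∞) := le_rfl
  have e0 : ⟪A η v, v⟫_ℝ = iteratedFDeriv ℝ 2 Φ ((0 : ℝ), (0 : GnoFol L)) (fun _ => ((0 : ℝ), v)) := by
    rw [hAyy, hsec0, iteratedFDeriv_fibre_apply hΦ2 h2]
  have e1 : ⟪A' η' v, v⟫_ℝ = iteratedFDeriv ℝ 2 Φ ((2 * D : ℝ), (0 : GnoFol L)) (fun _ => ((0 : ℝ), v)) := by
    rw [hAyy', hsec1, iteratedFDeriv_fibre_apply hΦ2 h2]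
  rw [e0, e1]
  have h := abs_hessianForm_sub_le_of_cubes hΦ3 convex_univ (A₃ := 536544 * (L : ℝ) ^ 4) (by positivity)
    (fun p _ w => chordDeficit_third_bound_norm z χ hq hq' hd hc η.2.2 p w) (mem_univ (((0 : ℝ), (0 : GnoFol L)) : ℝ × GnoFol L))
    (mem_univ (((2 * D : ℝ), (0 : GnoFol L)) : ℝ × GnoFol L)) ((0 : ℝ), v)
  refine h.trans ?_
  have hdist : ‖(((0 : ℝ), (0 : GnoFol L)) : ℝ × GnoFol L) - ((2 * D : ℝ), (0 : GnoFol L))‖ = 2 * D := by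
    rw [Prod.mk_sub_mk, sub_self, Prod.norm_def, norm_zero, zero_sub, norm_neg, Real.norm_eq_abs, abs_of_pos (by positivity), max_eq_left (by positivity)]
  have hv : ‖(((0 : ℝ), v) : ℝ × GnoFol L)‖ = ‖v‖ := by
    rw [Prod.norm_def, norm_zero, max_eq_right (norm_nonneg _)]
  rw [hdist, hv]
  ring_nf
  exact le_rfl

/-- ★★★ **THE ONE-LOOP COMPARISON OF THE FOLLOWER FACTOR IN THE LEADER TUPLE**: under the hypotheses of ✓`abs_gnoFolHessianForm_sub_le_leaders`, with `A`, `A′`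
symmetric, `A′ η′` `μ′`-coercive (`μ′ > 0`) and `3219264·L⁴·D ≤ μ′∕2`: `|log det A η − log det A′ η′| ≤ 2·(3|Fol L|)·(3219264L⁴D)∕μ′` — the follower one-loop weight
is matched between any two near-flat configurations whose LEADER TUPLES are within `D ≤ μ′∕(6438528L⁴)` in `ℍ⁴` (hub angle, axis tilt, large letters alike).
[cite: Breitung1994, Lemma 26] -/
theorem abs_log_det_gnoFolHessian_sub_le_leaders (z : Fin 3 → Bool) (χ : Site 3 L → SU2) {a a' : ℍ} (ε : GnoSign L)
    (hε : ε.2.2 = fun _ => true) {η η' : GnoCoord L} (hF : η.2.2 = η'.2.2)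
    {A A' : GnoCoord L → GnoFol L →ₗ[ℝ] GnoFol L} (hAs : ∀ η₁, (A η₁).IsSymmetric) (hAs' : ∀ η₁, (A' η₁).IsSymmetric)
    (hAyy : ∀ η₁ (y : GnoFol L), ⟪A η₁ y, y⟫_ℝ = iteratedFDeriv ℝ 2 (fun y' : GnoFol L => gnoDeficit z χ a ε (η₁ + gnoFolEmb y')) 0 (fun _ => y))
    (hAyy' : ∀ η₁ (y : GnoFol L), ⟪A' η₁ y, y⟫_ℝ = iteratedFDeriv ℝ 2 (fun y' : GnoFol L => gnoDeficit z χ a' ε (η₁ + gnoFolEmb y')) 0 (fun _ => y))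
    {D : ℝ} (hD0 : 0 < D) (hD1 : D ≤ 1)
    (hD : ∀ μ, ‖su2Quat ((blowUpPoint (L := L) 1 (gnomonicPoint a' ε η')).1 μ) - su2Quat ((blowUpPoint (L := L) 1 (gnomonicPoint a ε η)).1 μ)‖ ≤ D)
    {μ' : ℝ} (hμ : 0 < μ') (hcoer : ∀ y : GnoFol L, μ' * ‖y‖ ^ 2 ≤ ⟪A' η' y, y⟫_ℝ) (hnear : 3219264 * (L : ℝ) ^ 4 * D ≤ μ' / 2) :
    |Real.log (LinearMap.det (A η)) - Real.log (LinearMap.det (A' η'))| ≤ 2 * (3 * (Fintype.card (Fol L) : ℝ)) * (3219264 * (L : ℝ) ^ 4 * D) / μ' := by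
  have h := abs_log_det_sub_log_det_le (hAs η) (hAs' η') hμ (by positivity) hnear hcoer
    (fun y => abs_gnoFolHessianForm_sub_le_leaders z χ ε hε hF hAyy hAyy' hD0 hD1 hD y)
  rw [← finrank_gnoFol_real (L := L)]
  exact h

end Summit.QuantumFields.YangMills.Theorems.SwapVirialDeficit.BlowUpRing

end
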